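import Literature.MathematicalPhysics.QuantumFieldTheory.BalabanImbrieJaffe1984to88.BIJ88PolymerRep5134
import Literature.MathematicalPhysics.QuantumFieldTheory.BalabanImbrieJaffe1984to88.BIJ88ClusterFactorization306

/-!
# `BalabanImbrieJaffe1984to88.BIJ88PolymerRep5134Gauss` — T. Bałaban, J. Imbrie, A. Jaffe, *Effective action and cluster properties of the
abelian Higgs model*, Commun. Math. Phys. **114** (1988) 257–315 [BalabanImbrieJaffe1988], §5.13 pp. 305–306 [PDF 49–50]: **the Gaussian
expectations `⟨Π_{□_i⊂X} f(□_i)⟩_{s,X}` of the decoupling expansion ARE cluster-factorizing corner data**, hence **display (5.13.4) (left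
equality, polymer representation with the printed activities `g₁` in corner form) HOLDS FOR THEM** — the MODEL INSTANCE of this seat's
`BIJ88Clusters5134.IsClusterFactorizing` / `BIJ88PolymerRep5134.polymerRep` for the finite-dimensional Gaussian measures of p13's pp. 305–306 files
(`e^{−½⟨Φ,Δ_sΦ⟩}e^{⟨Φ,ℱ⟩}dΦ`, `Δ_s = BIJ88DirichletForms305.interpForm`), by transporting p13's two-sided Fubini factorization
`BIJ88ClusterFactorization306.expectation_factorizes` to the site types of sub-regions.

statement-level skeleton of published theorems with citation tags; proofs where landed; nothing here is a claim about the Yang–Mills mass gap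

PDF held: `paper:balaban1988-cmp114-bij-abelian-higgs-effective-action` (journal page = PDF page + 256); pp. 305–306 = PDF 49–50 rendered and
read as images this session (p25 seat `renders/original-p049-x2.png`, `…p050-x2.png`).

**The print (verbatim).** p. 304 [PDF 48]: *"f(□_i) is the product of all the factors under the dμ^{(k)}_{Λ^{(k)}_{10}} integral above that are
localized in □_i … The expectation ⟨ ⟩_1 is in the measure (1/N)∫dΦ|_{Λ^{(k)}_{10}} δ_{Ax}δ(…)(…) exp[½⟨Φ,ΔΦ⟩ + ⟨Φ,ℱ⟩]"*; p. 305: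
*"□_iΔ_s□_{i′} = s_is_{i′}□_iΔ□_{i′}, i′ ≠ i, □_iΔ_s□_i = □_iΔ□_i"*; p. 306: *"The form Δ has a range less than ½r(e_k). The f(□_i) do not
couple different □_i. Hence only adjacent □_i with s_i ≠ 0 interact in the above formula. Thus our expression … factorizes over the connected
components of Γ. … The expression also factorizes over the □_{i′}, i′ ∈ I∖Γ. … ⟨·⟩_{s_Γ,X} is defined by integrating over the fields in X
only."*

**The model.** Sites `α`, cubes `I` (finite types), `blk : α → I` (the cube of a site), a real matrix `Δ` (feed `Δ := −Δ_print`), a linear term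
`ℱ : α → ℝ`, observables `f i : (α → ℝ) → ℝ` that are `□_i`-LOCAL (`hf`: `f i φ` depends only on `φ` at the sites of cube `i`), an abutting
relation `adj` with the RANGE hypothesis `hΔ : blk x ≠ blk y → ¬adj (blk x) (blk y) → Δ x y = 0` (as in p13's `BIJ88CsClusters306`). For a region
`X : Finset I`: `Site blk X` (its sites), `ext` (a field on them, extended by `0`), `obs` (`Π_{i∈X} f i`), `prec X s` (the `X`-block of
`interpForm blk Δ s`), `src` (`ℱ` on `X`), **`expect X s`** = `∫ obs·e^{−½⟨φ,prec φ⟩}e^{⟨src,φ⟩}dφ / ∫ e^{−½⟨φ,prec φ⟩}e^{⟨src,φ⟩}dφ` over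
`Site blk X → ℝ` (p13's `weight`/`source` of `B2Eq228Conditioning`), and the corner expectations **`zG X Λ := expect X (corner ℝ Λ)`**.
* §2 THE FOUR PROPERTIES: `expect_empty` (`= 1`: one-point field space, `Measure.volume_pi_eq_dirac`); `prec_singleton`/`expect_singleton`
  (`□_iΔ_s□_i = □_iΔ□_i`: a one-cube marginal does not see `s`); `prec_ind_inter`/`zG_inter` (only the active cubes OF `X` matter);
  **`zG_union`** — FACTORIZATION across a cut met by no active abutting pair: `zG (X₁∪X₂) Λ = zG X₁ Λ · zG X₂ Λ` (the corner precision does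
  not couple the sites of `X₁` to those of `X₂` by `hΔ` + `interpForm_apply`; p13's `expectation_factorizes`; then `integral_transport` =
  relabelling of coordinates along `Site blk X₁ ≃ In p`, `Site blk X₂ ≃ Out p` by `MeasureTheory.volume_measurePreserving_piCongrLeft`, with
  `quadForm_transport`, `linForm_transport`, `obs_union_eq`).
* §3 **`isClusterFactorizing_zG`**: `IsClusterFactorizing adj (zG blk Δ ℱ f)`; **`polymerRep_gauss`** — DISPLAY (5.13.4), LEFT EQUALITY, FOR
  THESE GAUSSIAN EXPECTATIONS: `expect W (1_W) = Σ_{P ∈ setPartitions W, IsAdmissible adj P} Π_{X∈P} g1 adj (zG …) X` (fillings = cluster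
  configurations, `g1` = the printed `g₁` in corner form); `prec_ind_self` (at `s = 1_W` the `W`-precision is the `W`-block of `Δ`: the left
  side is the un-interpolated `⟨Π_{i∈W} f(□_i)⟩_1` over the fields of `W`).

**Honest scope.** Real scalar fields on finitely many sites (the paper's `Φ = (A″, φ″)` with the block-local constraints `δ_{Ax}` is a
finite-dimensional Gaussian on a product of per-cube subspaces — the constraint structure is not modelled, as in p13's files); no positivity
hypothesis is needed for the identities (Lean's `x/0 = 0`; positivity of the partition functions for `Δ ≻ 0`, `s ∈ [0,1]^I` is p13's
`BIJ88SDerivative305.integral_weight_mul_source_pos`); the activities are in CORNER form — their identification with the printed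
`∫ds_Γ ∂/∂s_Γ` (derivative form) is `BIJ88PolymerRep5134Deriv` under the smoothness hypotheses of p02's `ftc_expansion`, whose discharge for these
integrals (all mixed `s`-partials, cf. p13's first-order `hasDerivAt_expectation_interp`) is NOT done here; (5.13.3) not modelled. NOT summit
progress; NOT continuum; NOT Clay. Imports: `BIJ88PolymerRep5134`, `BIJ88ClusterFactorization306`; 0 `sorry`, 0 new `Prop` facts; modifies
nothing. Cell `lit-balaban` Phase 2, seat p25 gen 8; row C2.Eq5.13.3-5.13.4 (owner r16, referee ref-5).
-/

noncomputable section

namespace Literature.MathematicalPhysics.QuantumFieldTheory.BalabanImbrieJaffe1984to88.BIJ88PolymerRep5134Gauss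

open MeasureTheory Matrix Finset
open scoped BigOperators
open Literature.Probability.LatticeModels (IsSetPartition setPartitions mem_setPartitions)
open Literature.MathematicalPhysics.QuantumFieldTheory.Balaban1983to89
open B2Eq228Conditioning (In Out resIn resOut blkIn blkOut weight source)
open BIJ88DirichletForms305 (interpForm interpForm_apply)
open BIJ88ClusterFactorization306 (expectation_factorizes)
open BIJ88Clusters5134 BIJ88PolymerRep5134

variable {α I : Type} [Fintype α] [DecidableEq α] [Fintype I] [DecidableEq I]
  (blk : α → I) (Δ : Matrix α α ℝ) (ℱ : α → ℝ) (f : I → (α → ℝ) → ℝ)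

/-! ## §1 The expectations `⟨Π_{□_i⊂X} f(□_i)⟩_{s,X}` over the fields in a region `X` only -/

/-- the sites of the region `X` (a set of cubes): `∪_{i∈X} □_i`. [cite: BalabanImbrieJaffe1988, p.306 (Sect. 5.13)] -/
abbrev Site (X : Finset I) : Type := {x : α // blk x ∈ X}

/-- a field on the sites of `X`, extended by `0` (the value off `X` is never looked at by the `X`-local observables).
[cite: BalabanImbrieJaffe1988, p.306 (Sect. 5.13)] -/
def ext (X : Finset I) (φ : Site blk X → ℝ) : α → ℝ := fun x => if h : blk x ∈ X then φ ⟨x, h⟩ else 0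

/-- the observable `Π_{□_i ⊂ X} f(□_i)` on the fields of `X` (p. 304: *"f(□_i) is the product of all the factors … localized in □_i"*).
[cite: BalabanImbrieJaffe1988, p.306 (Sect. 5.13)] -/
def obs (X : Finset I) (φ : Site blk X → ℝ) : ℝ := ∏ i ∈ X, f i (ext blk X φ)

/-- the precision of the `X`-marginal at parameter `s`: the block of `Δ_s = interpForm blk Δ s` on the sites of `X` (feed `Δ := −Δ_print`).
[cite: BalabanImbrieJaffe1988, p.305 (Sect. 5.13)] -/
def prec (X : Finset I) (s : I → ℝ) : Matrix (Site blk X) (Site blk X) ℝ := (interpForm blk Δ s).submatrix Subtype.val Subtype.val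

/-- the linear term `ℱ` restricted to the sites of `X`. [cite: BalabanImbrieJaffe1988, p.305 (Sect. 5.13)] -/
def src (X : Finset I) : Site blk X → ℝ := fun x => ℱ x.1

/-- **`⟨Π_{□_i⊂X} f(□_i)⟩_{s,X}`** (p. 306: *"⟨·⟩_{s_Γ,X} is defined by integrating over the fields in X only"*): the normalized Gaussian
expectation `∫dΦ|_X Π f e^{−½⟨Φ,Δ_sΦ⟩}e^{⟨Φ,ℱ⟩} / ∫dΦ|_X e^{−½⟨Φ,Δ_sΦ⟩}e^{⟨Φ,ℱ⟩}` over the fields on the sites of `X` with the `X`-block of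
`Δ_s`. [cite: BalabanImbrieJaffe1988, p.306 (Sect. 5.13)] -/
def expect (X : Finset I) (s : I → ℝ) : ℝ :=
  (∫ φ, obs blk f X φ * (weight (prec blk Δ X s) φ * source (src blk ℱ X) φ))
    / ∫ φ, weight (prec blk Δ X s) φ * source (src blk ℱ X) φ

/-- **the corner expectations** `z X Λ := ⟨Π_{□_i⊂X} f(□_i)⟩_{1_Λ,X}` — the data of `BIJ88Clusters5134.IsClusterFactorizing` for the
Gaussian measures of §5.13. [cite: BalabanImbrieJaffe1988, p.306 (Sect. 5.13)] -/
def zG (X Λ : Finset I) : ℝ := expect blk Δ ℱ f X (corner ℝ Λ)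

/-! ## §2 The four properties -/

omit [Fintype I] in
/-- no cubes: no sites. [cite: BalabanImbrieJaffe1988, p.306 (Sect. 5.13)] -/
instance instIsEmptySiteEmpty : IsEmpty (Site blk (∅ : Finset I)) := ⟨fun x => notMem_empty _ x.2⟩

/-- **no cubes, expectation `1`** (the integrals over the one-point space of fields on no sites are the integrands at that point,
`Π_∅ = 1`, `e^0 = 1`). [cite: BalabanImbrieJaffe1988, p.306 (Sect. 5.13)] -/
theorem expect_empty (s : I → ℝ) : expect blk Δ ℱ f ∅ s = 1 := by
  have hv : (volume : Measure (Site blk (∅ : Finset I) → ℝ)) = Measure.dirac isEmptyElim := Measure.volume_pi_eq_dirac _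
  have hw : ∀ φ : Site blk (∅ : Finset I) → ℝ, weight (prec blk Δ ∅ s) φ * source (src blk ℱ ∅) φ = 1 := by
    intro φ
    simp [B2Eq228Conditioning.weight, B2Eq228Conditioning.source, dotProduct]
  simp only [expect, hw, mul_one, hv, integral_dirac, obs, prod_empty, div_one]

/-- the precision of a one-cube marginal does not depend on the parameters (`□_iΔ_s□_i = □_iΔ□_i`, p. 305).
[cite: BalabanImbrieJaffe1988, p.305 (Sect. 5.13)] -/
theorem prec_singleton (i : I) (s s' : I → ℝ) : prec blk Δ {i} s = prec blk Δ {i} s' := by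
  ext x y
  have hx : blk x.1 = i := mem_singleton.1 x.2
  have hy : blk y.1 = i := mem_singleton.1 y.2
  simp only [prec, submatrix_apply, interpForm_apply, hx, hy, if_true]

/-- **a single cube carries no interpolation**: `⟨f(□_i)⟩_{s,{i}}` is independent of `s`. [cite: BalabanImbrieJaffe1988, p.305 (Sect. 5.13)] -/
theorem expect_singleton (i : I) (s s' : I → ℝ) : expect blk Δ ℱ f {i} s = expect blk Δ ℱ f {i} s' := by
  simp only [expect, prec_singleton blk Δ i s s']

/-- the precision of the `X`-marginal at a corner sees only the active cubes of `X`. [cite: BalabanImbrieJaffe1988, p.305 (Sect. 5.13)] -/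
theorem prec_ind_inter (X Λ : Finset I) : prec blk Δ X (corner ℝ Λ) = prec blk Δ X (corner ℝ (Λ ∩ X)) := by
  ext x y
  simp only [prec, submatrix_apply, interpForm_apply, corner, mem_inter, x.2, y.2, and_true]

/-- **only the active cubes of the region matter**: `z X Λ = z X (Λ ∩ X)`. [cite: BalabanImbrieJaffe1988, p.306 (Sect. 5.13)] -/
theorem zG_inter (X Λ : Finset I) : zG blk Δ ℱ f X Λ = zG blk Δ ℱ f X (Λ ∩ X) := by
  simp only [zG, expect, prec_ind_inter blk Δ X Λ]

/-! ### The factorization across a cut met by no active abutting pair -/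

section Split

variable {blk}
variable {X₁ X₂ : Finset I}

/-- the sites of `X₁` inside the sites of `X₁ ∪ X₂`. [cite: BalabanImbrieJaffe1988, p.306 (Sect. 5.13)] -/
def inl : Site blk X₁ ≃ In (fun y : Site blk (X₁ ∪ X₂) => blk y.1 ∈ X₁) where
  toFun x := ⟨⟨x.1, mem_union_left _ x.2⟩, x.2⟩
  invFun y := ⟨y.1.1, y.2⟩
  left_inv _ := rfl
  right_inv _ := rfl

/-- the sites of `X₂` inside the sites of `X₁ ∪ X₂` (disjoint regions). [cite: BalabanImbrieJaffe1988, p.306 (Sect. 5.13)] -/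
def inr (hd : Disjoint X₁ X₂) : Site blk X₂ ≃ Out (fun y : Site blk (X₁ ∪ X₂) => blk y.1 ∈ X₁) where
  toFun x := ⟨⟨x.1, mem_union_right _ x.2⟩, fun h => disjoint_left.1 hd h x.2⟩
  invFun y := ⟨y.1.1, (mem_union.1 y.1.2).resolve_left y.2⟩
  left_inv _ := rfl
  right_inv _ := rfl

/-- transport of an integral over fields on `In p` to fields on the sites of `X₁` (relabelling of coordinates, Lebesgue measure
preserved). [cite: BalabanImbrieJaffe1988, p.306 (Sect. 5.13)] -/
theorem integral_transport {T T' : Type} [Fintype T] [Fintype T'] (e : T' ≃ T) (g : (T → ℝ) → ℝ) :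
    ∫ x : T → ℝ, g x = ∫ ψ : T' → ℝ, g (fun t => ψ (e.symm t)) := by
  have hmp : MeasurePreserving (MeasurableEquiv.piCongrLeft (fun _ : T => ℝ) e) volume volume :=
    volume_measurePreserving_piCongrLeft (fun _ : T => ℝ) e
  rw [← hmp.integral_comp' (f := MeasurableEquiv.piCongrLeft (fun _ : T => ℝ) e) g]
  refine integral_congr_ae (Filter.Eventually.of_forall fun ψ => ?_)
  show g _ = g _
  congr 1
  funext t
  have h := MeasurableEquiv.piCongrLeft_apply_apply e (β := fun _ : T => ℝ) ψ (e.symm t)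
  rw [Equiv.apply_symm_apply] at h
  exact h

/-- the quadratic form relabelled. [cite: BalabanImbrieJaffe1988, p.306 (Sect. 5.13)] -/
theorem quadForm_transport {T T' : Type} [Fintype T] [Fintype T'] (e : T' ≃ T) (M : Matrix T T ℝ) (ψ : T' → ℝ) :
    (fun t => ψ (e.symm t)) ⬝ᵥ M *ᵥ (fun t => ψ (e.symm t)) = ψ ⬝ᵥ (M.submatrix e e) *ᵥ ψ := by
  simp only [dotProduct, mulVec, submatrix_apply]
  rw [← e.sum_comp]
  refine sum_congr rfl fun a _ => ?_
  rw [Equiv.symm_apply_apply, ← e.sum_comp]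
  simp only [Equiv.symm_apply_apply]

/-- the linear form relabelled. [cite: BalabanImbrieJaffe1988, p.306 (Sect. 5.13)] -/
theorem linForm_transport {T T' : Type} [Fintype T] [Fintype T'] (e : T' ≃ T) (g : T → ℝ) (ψ : T' → ℝ) :
    ∑ t, g t * ψ (e.symm t) = ∑ a, g (e a) * ψ a := by
  rw [← e.sum_comp]
  simp only [Equiv.symm_apply_apply]

variable (blk)

omit [Fintype α] [DecidableEq α] [Fintype I] in
/-- the `X`-local product observable depends on the field through the sites of `X` only, for cube-local `f(□_i)`.
[cite: BalabanImbrieJaffe1988, p.306 (Sect. 5.13)] -/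
theorem obs_union_eq (hd : Disjoint X₁ X₂) (hf : ∀ i (φ ψ : α → ℝ), (∀ x, blk x = i → φ x = ψ x) → f i φ = f i ψ)
    (φ : Site blk (X₁ ∪ X₂) → ℝ) :
    obs blk f (X₁ ∪ X₂) φ
      = obs blk f X₁ (fun a => resIn (fun y : Site blk (X₁ ∪ X₂) => blk y.1 ∈ X₁) φ (inl a))
        * obs blk f X₂ (fun b => resOut (fun y : Site blk (X₁ ∪ X₂) => blk y.1 ∈ X₁) φ (inr hd b)) := by
  rw [obs, prod_union hd, obs, obs]
  congr 1
  · refine prod_congr rfl fun i hi => hf i _ _ fun x hx => ?_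
    have hx₁ : blk x ∈ X₁ := hx ▸ hi
    simp only [ext, dif_pos (mem_union_left X₂ hx₁), dif_pos hx₁, B2Eq228Conditioning.resIn, inl, Equiv.coe_fn_mk]
  · refine prod_congr rfl fun i hi => hf i _ _ fun x hx => ?_
    have hx₂ : blk x ∈ X₂ := hx ▸ hi
    simp only [ext, dif_pos (mem_union_right X₁ hx₂), dif_pos hx₂, B2Eq228Conditioning.resOut, inr, Equiv.coe_fn_mk]

/-- the `In`-marginal integral of the splitting is the `X₁`-integral. [cite: BalabanImbrieJaffe1988, p.306 (Sect. 5.13)] -/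
theorem integral_in_eq (s : I → ℝ) (F₁ : (Site blk X₁ → ℝ) → ℝ) :
    ∫ x : In (fun y : Site blk (X₁ ∪ X₂) => blk y.1 ∈ X₁) → ℝ,
        F₁ (fun a => x (inl a)) * (weight (blkIn _ (prec blk Δ (X₁ ∪ X₂) s)) x
          * source (resIn (fun y : Site blk (X₁ ∪ X₂) => blk y.1 ∈ X₁) (src blk ℱ (X₁ ∪ X₂))) x)
      = ∫ ψ : Site blk X₁ → ℝ, F₁ ψ * (weight (prec blk Δ X₁ s) ψ * source (src blk ℱ X₁) ψ) := by
  rw [integral_transport (inl (blk := blk) (X₁ := X₁) (X₂ := X₂))]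
  refine integral_congr_ae (Filter.Eventually.of_forall fun ψ => ?_)
  have h1 : (fun a => (fun t => ψ ((inl (blk := blk) (X₁ := X₁) (X₂ := X₂)).symm t)) (inl a)) = ψ := by
    funext a
    simp only [Equiv.symm_apply_apply]
  simp only [h1, B2Eq228Conditioning.weight, B2Eq228Conditioning.source, quadForm_transport, linForm_transport]
  rfl

/-- the `Out`-marginal integral of the splitting is the `X₂`-integral. [cite: BalabanImbrieJaffe1988, p.306 (Sect. 5.13)] -/
theorem integral_out_eq (hd : Disjoint X₁ X₂) (s : I → ℝ) (F₂ : (Site blk X₂ → ℝ) → ℝ) :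
    ∫ y : Out (fun y : Site blk (X₁ ∪ X₂) => blk y.1 ∈ X₁) → ℝ,
        F₂ (fun b => y (inr hd b)) * (weight (blkOut _ (prec blk Δ (X₁ ∪ X₂) s)) y
          * source (resOut (fun y : Site blk (X₁ ∪ X₂) => blk y.1 ∈ X₁) (src blk ℱ (X₁ ∪ X₂))) y)
      = ∫ ψ : Site blk X₂ → ℝ, F₂ ψ * (weight (prec blk Δ X₂ s) ψ * source (src blk ℱ X₂) ψ) := by
  rw [integral_transport (inr (blk := blk) hd)]
  refine integral_congr_ae (Filter.Eventually.of_forall fun ψ => ?_)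
  have h1 : (fun b => (fun t => ψ ((inr (blk := blk) hd).symm t)) (inr hd b)) = ψ := by
    funext b
    simp only [Equiv.symm_apply_apply]
  simp only [h1, B2Eq228Conditioning.weight, B2Eq228Conditioning.source, quadForm_transport, linForm_transport]
  rfl

/-- **FACTORIZATION** (p. 306: *"The f(□_i) do not couple different □_i. Hence only adjacent □_i with s_i ≠ 0 interact … factorizes over the
connected components of Γ … also over the □_{i′}, i′ ∈ I∖Γ"*): if `Δ` couples different cubes only when they abut (`hΔ`, range), the
`f(□_i)` are cube-local (`hf`), and no abutting pair of ACTIVE cubes joins `X₁` to `X₂`, then at the corner `1_Λ`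
`⟨Π_{X₁∪X₂} f⟩_{X₁∪X₂} = ⟨Π_{X₁} f⟩_{X₁} · ⟨Π_{X₂} f⟩_{X₂}` (Fubini: `BIJ88ClusterFactorization306.expectation_factorizes` of p13, transported
to the site types of `X₁`, `X₂`). [cite: BalabanImbrieJaffe1988, p.306 (Sect. 5.13)] -/
theorem zG_union (adj : I → I → Prop) (hΔ : ∀ x y, blk x ≠ blk y → ¬ adj (blk x) (blk y) → Δ x y = 0)
    (hf : ∀ i (φ ψ : α → ℝ), (∀ x, blk x = i → φ x = ψ x) → f i φ = f i ψ) (hd : Disjoint X₁ X₂) {Λ : Finset I}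
    (hcut : ∀ j ∈ X₁, ∀ j' ∈ X₂, j ∈ Λ → j' ∈ Λ → ¬ adj j j' ∧ ¬ adj j' j) :
    zG blk Δ ℱ f (X₁ ∪ X₂) Λ = zG blk Δ ℱ f X₁ Λ * zG blk Δ ℱ f X₂ Λ := by
  let p : Site blk (X₁ ∪ X₂) → Prop := fun y => blk y.1 ∈ X₁
  -- the precision at the corner does not couple the sites of X₁ to those of X₂
  have hA : ∀ u v : Site blk (X₁ ∪ X₂), p u → ¬ p v → prec blk Δ (X₁ ∪ X₂) (corner ℝ Λ) u v = 0 := by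
    intro u v (hu : blk u.1 ∈ X₁) (hv : ¬ blk v.1 ∈ X₁)
    have hv₂ : blk v.1 ∈ X₂ := (mem_union.1 v.2).resolve_left hv
    have hne : blk u.1 ≠ blk v.1 := fun h => hv (h ▸ hu)
    simp only [prec, submatrix_apply, interpForm_apply, if_neg hne, corner]
    by_cases huΛ : blk u.1 ∈ Λ
    · by_cases hvΛ : blk v.1 ∈ Λ
      · rw [hΔ u.1 v.1 hne (hcut _ hu _ hv₂ huΛ hvΛ).1, mul_zero]
      · simp [hvΛ]
    · simp [huΛ]
  have hA' : ∀ u v : Site blk (X₁ ∪ X₂), ¬ p u → p v → prec blk Δ (X₁ ∪ X₂) (corner ℝ Λ) u v = 0 := by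
    intro u v (hu : ¬ blk u.1 ∈ X₁) (hv : blk v.1 ∈ X₁)
    have hu₂ : blk u.1 ∈ X₂ := (mem_union.1 u.2).resolve_left hu
    have hne : blk u.1 ≠ blk v.1 := fun h => hu (h ▸ hv)
    simp only [prec, submatrix_apply, interpForm_apply, if_neg hne, corner]
    by_cases huΛ : blk u.1 ∈ Λ
    · by_cases hvΛ : blk v.1 ∈ Λ
      · rw [hΔ u.1 v.1 hne (hcut _ hv _ hu₂ hvΛ huΛ).2, mul_zero]
      · simp [hvΛ]
    · simp [huΛ]
  have hfac := expectation_factorizes p hA hA' (src blk ℱ (X₁ ∪ X₂))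
    (fun x => obs blk f X₁ fun a => x (inl a)) (fun y => obs blk f X₂ fun b => y (inr hd b))
  have hobs : ∀ φ : Site blk (X₁ ∪ X₂) → ℝ, obs blk f (X₁ ∪ X₂) φ
      = (obs blk f X₁ fun a => resIn p φ (inl a)) * obs blk f X₂ fun b => resOut p φ (inr hd b) :=
    obs_union_eq blk f hd hf
  simp only [zG, expect]
  simp_rw [hobs]
  rw [hfac, integral_in_eq blk Δ ℱ (corner ℝ Λ) (obs blk f X₁), integral_out_eq blk Δ ℱ hd (corner ℝ Λ) (obs blk f X₂)]
  have h1 := integral_in_eq blk Δ ℱ (X₁ := X₁) (X₂ := X₂) (corner ℝ Λ) (fun _ => (1 : ℝ))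
  have h2 := integral_out_eq blk Δ ℱ hd (corner ℝ Λ) (fun _ => (1 : ℝ))
  simp only [one_mul] at h1 h2
  rw [h1, h2]

end Split

/-! ## §3 The Gaussian corner expectations are cluster-factorizing; display (5.13.4) for them -/

/-- **the Gaussian expectations of §5.13 are cluster-factorizing corner data** (range of `Δ` + cube-locality of the `f(□_i)`):
`IsClusterFactorizing adj (zG blk Δ ℱ f)`. [cite: BalabanImbrieJaffe1988, p.306 (Sect. 5.13)] -/
theorem isClusterFactorizing_zG (adj : I → I → Prop) (hΔ : ∀ x y, blk x ≠ blk y → ¬ adj (blk x) (blk y) → Δ x y = 0)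
    (hf : ∀ i (φ ψ : α → ℝ), (∀ x, blk x = i → φ x = ψ x) → f i φ = f i ψ) :
    IsClusterFactorizing adj (zG blk Δ ℱ f) where
  empty _ := expect_empty blk Δ ℱ f _
  local_inter X Λ := zG_inter blk Δ ℱ f X Λ
  split _ _ _ hd hcut := zG_union blk Δ ℱ f adj hΔ hf hd hcut
  single i := expect_singleton blk Δ ℱ f i _ _

/-- **DISPLAY (5.13.4), LEFT EQUALITY, FOR THE GAUSSIAN MEASURES OF §5.13** (finite-dimensional model: real fields on finitely many sites,
weight `e^{−½⟨Φ,Δ_sΦ⟩}e^{⟨Φ,ℱ⟩}dΦ` with the interpolated precision `Δ_s` of p. 305, cube-local observables `f(□_i)`, `Δ` coupling only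
abutting cubes): `⟨Π_{i∈W} f(□_i)⟩_{1,W} = Σ_{{X_α} admissible filling of W} Π_α g₁(X_α)` with the printed activities
`g₁(X) = Σ_{Γ⊆X: X single cluster} ∫ds_Γ∂_Γ⟨Π_{□_i⊂X}f(□_i)⟩_{s_Γ,X}` in corner form. [cite: BalabanImbrieJaffe1988, (5.13.4) p.306] -/
theorem polymerRep_gauss (adj : I → I → Prop) [DecidableRel adj] (hΔ : ∀ x y, blk x ≠ blk y → ¬ adj (blk x) (blk y) → Δ x y = 0)
    (hf : ∀ i (φ ψ : α → ℝ), (∀ x, blk x = i → φ x = ψ x) → f i φ = f i ψ) (W : Finset I) :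
    expect blk Δ ℱ f W (corner ℝ W)
      = ∑ P ∈ (setPartitions W).filter (IsAdmissible adj), ∏ X ∈ P, g1 adj (zG blk Δ ℱ f) X :=
  polymerRep (isClusterFactorizing_zG blk Δ ℱ f adj hΔ hf) W

/-- at `s ≡ 1` on `W` the `W`-marginal precision is the `W`-block of `Δ` itself (`Δ_{s≡1} = Δ`, p. 305), so the left side of
`polymerRep_gauss` is the un-interpolated expectation `⟨Π_{i∈W} f(□_i)⟩_1` over the fields of `W`. [cite: BalabanImbrieJaffe1988, p.305 (Sect. 5.13)] -/
theorem prec_ind_self (W : Finset I) : prec blk Δ W (corner ℝ W) = Δ.submatrix Subtype.val Subtype.val := by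
  ext x y
  simp only [prec, submatrix_apply, interpForm_apply, corner, x.2, y.2, if_true, one_mul, ite_self]

end Literature.MathematicalPhysics.QuantumFieldTheory.BalabanImbrieJaffe1984to88.BIJ88PolymerRep5134Gauss

end
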